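import Mathlib.RingTheory.Jacobson.Ring
import Mathlib.FieldTheory.IsAlgClosed.Basic
import Mathlib.Analysis.Complex.Polynomial.Basic
import Literature.Computability.AlgebraicComplexity.BurgisserBooleanParts
import HarnessLib

/-!
# Steps of the proof of (A3) `BP(VP_k) ⊆ FP/poly` (Bürgisser 2000 TCS, §5 (A3)), GRH-free part

Trunk T-CPLX-ALG. Towards the discharge of the named fact `Literature.PNP.booleanPart_VP_cktSize k` of
`BurgisserBooleanParts.lean` (Bürgisser, *Cook's versus Valiant's hypothesis*, TCS 235 (2000),
Thm. 1.1(1), proof in §5 (A3), pp. 85–86). The printed proof: replace the constants of a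
polynomial-size circuit for `f_n` by indeterminates `Y` (integer skeleton `F_n(X, Y)` with
degree and weight bounds, Lemma 2.4); the system `F_n(x, Y) = f_n(x)`, `x ∈ {0,1}ⁿ`, solvable in
`k`, is solvable over `ℂ` (Nullstellensatz); Thm. 4.1 (GRH, the named fact
`reduction_mod_primes_of_GRH`) gives `π_{S_n}(2^{n^c}) > 2^{t(n)}`, hence a prime
`p_n > 2^{t(n)}` of polynomial bit-size with a solution `y_n` over `𝔽_{p_n}`; simulating the
circuit over `𝔽_{p_n}` by Boolean circuits computes the bits of `f_n(x) = F_n(x, y_n) mod p_n`.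

This file proves GRH-free steps of this argument:

* `exists_complex_solution_of_charZero` — **transfer to `ℂ`**: an integer system with a solution
  in a field of characteristic zero has a complex solution (p. 85, "By the Nullstellensatz …";
  here via Zariski's lemma `finite_of_finite_type_of_isJacobsonRing` and `IsAlgClosed.lift`);
* `exists_prime_gt_of_lt_solvableModPrimeCount` — **prime selection**: if more than `B` primes
  `p ≤ x` admit a solution modulo `p`, one of them exceeds `B` (p. 85);
* the **weight API** for Lemma 2.4-type bounds (p. 76: the weight `wt`, `weight` of the parent
  file, is subadditive and submultiplicative; `wt(X_i) = 1`, `wt(C c) = |c|`, invariance under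
  injective renaming) and `natAbs_eval_le_weight` (`|f(z)| ≤ wt(f)` for `|z_i| ≤ 1`, behind
  "`wt(F_n(x, Y)) ≤ wt(F_n)` for `x ∈ {0,1}ⁿ`", p. 85);
* the **size form of Lemma 2.4** (p. 77: `deg f ≤ 2^{d*}`, `log wt(f) ≤ (d⁺ + 1) 2^{d*} log b` for a
  straight-line program with multiplicative/additive depths `d*, d⁺` and integer constants of
  absolute value `≤ b`): for the tree's fan-in-two circuits (`ArithCircuit`, `IsFanInTwo`) every
  gate value has degree `≤ 2^s` (`totalDegree_eval_le_two_pow_size`), and for constant-free ones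
  (`HasSignConstants`, constants in `{0, ±1}`) weight `≤ 2^(2^s)` (`weight_eval_le_two_pow_two_pow_size`),
  `s` the number of gates (both depths are `≤ s`; these are the bounds for the integer skeleton
  `F_n` of (A3)).

* the **skeleton lemma** (p. 85: "Replace the `y_j` by indeterminates `Y_j` and let `F_n(X, Y)`
  denote the integer polynomial computed by `Γ_n` from the `X_i` and `Y_j` … Obviously,
  `F_n(X, y) = f_n`"): `skeleton P`, the constant-free fan-in-two circuit over `ℤ` with three gates
  per gate of `P` (a weighted sum `c u + d v` becomes `Y u' `, `Y' v'` and their sum) in the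
  variables of `P` and `4 s + 1` slot indeterminates (one per coefficient / constant-operand
  position and one for the output), `slotConst P` (the constants of `P` slot by slot),
  `aeval_slotSubst_skeleton` (substituting them back gives `P.eval`, for fan-in-two `P`; proved
  through the invariant that skeleton gate `3 i + 2` evaluates back to gate `i`) and the packaged
  `exists_skeleton` (with the degree and weight bounds above at size `3 s`).

Remaining for (A3) (recorded in the parent file's decomposition): the Boolean simulation of
constant-free circuits over `𝔽_p` with hard-wired constants, the analytic comparison of the two
sides of Thm. 4.1 at `x = 2^{n^c}`, and Thm. 4.1 itself (GRH).

## References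

* P. Bürgisser, *Cook's versus Valiant's hypothesis*, Theoret. Comput. Sci. 235 (2000) 71–88,
  §2 p. 76 (weight), Lemma 2.4 p. 77, §5 (A3) pp. 85–86.
-/

noncomputable section

open scoped Classical
open MvPolynomial Literature.Computability.Complexity Literature.Computability.AlgebraicComplexity

namespace Literature.Computability.AlgebraicComplexity

/-- **Prime selection** (Bürgisser 2000 TCS, §5 (A3), p. 85: "`π_{S_n}(2^{n^c}) > 2^{t(n)}` …
Therefore, there is some prime number `p_n` satisfying `t(n) < log p_n ≤ n^c` such that `(S_n)` is
solvable over `𝔽_{p_n}`"): if more than `B` primes `p ≤ x` admit a solution of `S` modulo `p`, one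
of them exceeds `B`. [cite: Burgisser2000TCS, §5 (A3) p. 85] -/
theorem exists_prime_gt_of_lt_solvableModPrimeCount {n s : ℕ} (S : Fin s → MvPolynomial (Fin n) ℤ)
    {x B : ℕ} (h : B < solvableModPrimeCount S x) :
    ∃ p : ℕ, p.Prime ∧ B < p ∧ p ≤ x ∧ ∃ z : Fin n → ZMod p, ∀ i, aeval z (S i) = 0 := by
  by_contra hcon
  push Not at hcon
  unfold solvableModPrimeCount at h
  revert h
  rw [imp_false, not_lt]
  calc ((Finset.range (x + 1)).filter fun p =>
          p.Prime ∧ ∃ z : Fin n → ZMod p, ∀ i, aeval z (S i) = 0).card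
      ≤ (Finset.Icc 2 B).card := by
        refine Finset.card_le_card fun p hp => ?_
        simp only [Finset.mem_filter, Finset.mem_range] at hp
        obtain ⟨hpx, hprime, z, hz⟩ := hp
        have hpB : p ≤ B := by
          by_contra hlt
          exact absurd hz (by
            have := hcon p hprime (not_le.1 hlt) (Nat.lt_succ_iff.1 hpx) z
            obtain ⟨i, hi⟩ := this
            exact fun hall => hi (hall i))
        exact Finset.mem_Icc.2 ⟨hprime.two_le, hpB⟩
    _ ≤ B := by simp


/-- **Transfer of solvability to `ℂ`** (Bürgisser 2000 TCS, §5 (A3), p. 85: "By the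
Nullstellensatz, the system `(S_n)` is also solvable over the algebraic closure of `ℚ` and thus
over `ℂ`"): an integer polynomial system with a solution in some field of characteristic zero has
a complex solution. Proof: the kernel of `ℚ[Y] → k`, `Y ↦ z`, is a proper ideal containing the
system; a maximal ideal above it has residue field finite over `ℚ` (Zariski's lemma,
`finite_of_finite_type_of_isJacobsonRing`), which embeds into `ℂ` (`IsAlgClosed.lift`). [cite: Burgisser2000TCS, §5 (A3) p. 85] -/
theorem exists_complex_solution_of_charZero {k : Type*} [Field k] [CharZero k] {m s : ℕ}
    (S : Fin s → MvPolynomial (Fin m) ℤ) (h : ∃ z : Fin m → k, ∀ i, aeval z (S i) = 0) :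
    ∃ z : Fin m → ℂ, ∀ i, aeval z (S i) = 0 := by
  obtain ⟨z, hz⟩ := h
  let φ : MvPolynomial (Fin m) ℚ →ₐ[ℚ] k := aeval z
  obtain ⟨M, hM, hPM⟩ := Ideal.exists_le_maximal (RingHom.ker φ.toRingHom)
    (RingHom.ker_ne_top φ.toRingHom)
  let L := MvPolynomial (Fin m) ℚ ⧸ M
  letI : Field L := Ideal.Quotient.field M
  haveI : Algebra.FiniteType ℚ L :=
    Algebra.FiniteType.of_surjective (Ideal.Quotient.mkₐ ℚ M) (Ideal.Quotient.mkₐ_surjective ℚ M)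
  haveI : Module.Finite ℚ L := finite_of_finite_type_of_isJacobsonRing ℚ L
  haveI : Algebra.IsAlgebraic ℚ L := Algebra.IsAlgebraic.of_finite ℚ L
  let ψ : L →ₐ[ℚ] ℂ := IsAlgClosed.lift
  let z' : Fin m → ℂ := fun j => ψ (Ideal.Quotient.mk M (X j))
  have hfg : (aeval z').toRingHom =
      ψ.toRingHom.comp ((Ideal.Quotient.mk M).comp (MvPolynomial.map (Int.castRingHom ℚ))) := by
    refine MvPolynomial.ringHom_ext (fun r => ?_) (fun j => ?_)
    · exact RingHom.congr_fun (RingHom.ext_int ((aeval z').toRingHom.comp C)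
        ((ψ.toRingHom.comp ((Ideal.Quotient.mk M).comp (MvPolynomial.map (Int.castRingHom ℚ)))).comp C)) r
    · simp [z']
  refine ⟨z', fun i => ?_⟩
  have hi : Ideal.Quotient.mk M (MvPolynomial.map (Int.castRingHom ℚ) (S i)) = 0 := by
    rw [Ideal.Quotient.eq_zero_iff_mem]
    apply hPM
    rw [RingHom.mem_ker]
    show aeval z (MvPolynomial.map (Int.castRingHom ℚ) (S i)) = 0
    rw [show Int.castRingHom ℚ = algebraMap ℤ ℚ from rfl, aeval_map_algebraMap]
    exact hz i
  have := RingHom.congr_fun hfg (S i)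
  simp only [AlgHom.toRingHom_eq_coe, RingHom.coe_coe, RingHom.coe_comp, Function.comp_apply] at this
  rw [this, hi, map_zero]


/-! ### The weight (`ℓ¹`-norm) of integer polynomials: API for Lemma 2.4-type bounds -/

section Weight

variable {σ : Type*}

/-- The weight as a sum over any finite set containing the support. [folklore] -/
theorem weight_eq_sum_of_support_subset (f : MvPolynomial σ ℤ) {S : Finset (σ →₀ ℕ)}
    (hS : f.support ⊆ S) : weight f = ∑ m ∈ S, (f.coeff m).natAbs := by
  unfold weight
  refine Finset.sum_subset hS fun m _ hm => ?_
  rw [MvPolynomial.notMem_support_iff.1 hm, Int.natAbs_zero]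

/-- `wt(monomial m c) = |c|`. [folklore] -/
theorem weight_monomial (m : σ →₀ ℕ) (c : ℤ) : weight (MvPolynomial.monomial m c) = c.natAbs := by
  rcases eq_or_ne c 0 with rfl | hc
  · simp [weight]
  · rw [weight, MvPolynomial.support_monomial, if_neg hc, Finset.sum_singleton,
      MvPolynomial.coeff_monomial, if_pos rfl]

/-- `wt(X_i) = 1`. [folklore] -/
@[simp] theorem weight_X (i : σ) : weight (X i : MvPolynomial σ ℤ) = 1 := by
  rw [X, weight_monomial]; rfl

/-- `wt(C c) = |c|`. [folklore] -/
@[simp] theorem weight_C (c : ℤ) : weight (C c : MvPolynomial σ ℤ) = c.natAbs := by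
  rw [C_apply, weight_monomial]

/-- `wt(1) = 1`. [folklore] -/
@[simp] theorem weight_one : weight (1 : MvPolynomial σ ℤ) = 1 := by
  rw [← C_1, weight_C]; rfl

/-- Subadditivity `wt(f + g) ≤ wt(f) + wt(g)` (Bürgisser 2000 TCS, p. 76: "The weight is …
subadditive"). [cite: Burgisser2000TCS, §2 p. 76] -/
theorem weight_add_le (f g : MvPolynomial σ ℤ) : weight (f + g) ≤ weight f + weight g := by
  rw [weight_eq_sum_of_support_subset (f + g) (MvPolynomial.support_add (p := f) (q := g)),
    weight_eq_sum_of_support_subset f Finset.subset_union_left,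
    weight_eq_sum_of_support_subset g Finset.subset_union_right, ← Finset.sum_add_distrib]
  exact Finset.sum_le_sum fun m _ => by rw [MvPolynomial.coeff_add]; exact Int.natAbs_add_le _ _

/-- `wt(-f) = wt(f)`. [folklore] -/
@[simp] theorem weight_neg (f : MvPolynomial σ ℤ) : weight (-f) = weight f := by
  simp [weight, MvPolynomial.support_neg]

/-- `wt(∑ᵢ fᵢ) ≤ ∑ᵢ wt(fᵢ)`. [cite: Burgisser2000TCS, §2 p. 76] -/
theorem weight_finset_sum_le {ι : Type*} (s : Finset ι) (f : ι → MvPolynomial σ ℤ) :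
    weight (∑ i ∈ s, f i) ≤ ∑ i ∈ s, weight (f i) := by
  induction s using Finset.cons_induction with
  | empty => simp [weight]
  | cons a s ha ih =>
    rw [Finset.sum_cons, Finset.sum_cons]
    exact (weight_add_le _ _).trans (Nat.add_le_add_left ih _)

/-- Submultiplicativity `wt(f g) ≤ wt(f) wt(g)` (Bürgisser 2000 TCS, p. 76: "The weight is
submultiplicative"). [cite: Burgisser2000TCS, §2 p. 76] -/
theorem weight_mul_le (f g : MvPolynomial σ ℤ) : weight (f * g) ≤ weight f * weight g := by
  classical
  rw [MvPolynomial.mul_def, MvPolynomial.sum_def]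
  refine (weight_finset_sum_le _ _).trans ?_
  calc ∑ m ∈ f.support, weight ((AddMonoidAlgebra.coeff g).sum fun n b =>
          MvPolynomial.monomial (m + n) (f.coeff m * b))
      ≤ ∑ m ∈ f.support, ∑ n ∈ g.support, (f.coeff m * g.coeff n).natAbs := by
        refine Finset.sum_le_sum fun m _ => ?_
        rw [MvPolynomial.sum_def]
        refine (weight_finset_sum_le _ _).trans (le_of_eq ?_)
        exact Finset.sum_congr rfl fun n _ => weight_monomial _ _
    _ = weight f * weight g := by
        simp only [Int.natAbs_mul, ← Finset.mul_sum, ← Finset.sum_mul]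
        rfl

/-- `wt(∏ᵢ fᵢ) ≤ ∏ᵢ wt(fᵢ)`. [cite: Burgisser2000TCS, §2 p. 76] -/
theorem weight_finset_prod_le {ι : Type*} (s : Finset ι) (f : ι → MvPolynomial σ ℤ) :
    weight (∏ i ∈ s, f i) ≤ ∏ i ∈ s, weight (f i) := by
  induction s using Finset.cons_induction with
  | empty => simp
  | cons a s ha ih =>
    rw [Finset.prod_cons, Finset.prod_cons]
    exact (weight_mul_le _ _).trans (Nat.mul_le_mul_left _ ih)

/-- The weight is invariant under injective renaming of variables. [folklore] -/
theorem weight_rename_of_injective {τ : Type*} {e : σ → τ} (he : Function.Injective e)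
    (f : MvPolynomial σ ℤ) : weight (MvPolynomial.rename e f) = weight f := by
  classical
  unfold weight
  rw [MvPolynomial.support_rename_of_injective he,
    Finset.sum_image fun a _ b _ h => Finsupp.mapDomain_injective he h]
  refine Finset.sum_congr rfl fun m _ => ?_
  rw [MvPolynomial.coeff_rename_mapDomain e he]

/-- `|f(z)| ≤ wt(f)` at points with coordinates in `{0, 1}`… more generally of absolute value
`≤ 1`: `|eval z f| ≤ wt(f)` (Bürgisser 2000 TCS, p. 85: "`wt(F_n(x, Y)) ≤ wt(F_n)` for
`x ∈ {0,1}ⁿ`" rests on this). [cite: Burgisser2000TCS, §5 (A3) p. 85] -/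
theorem natAbs_eval_le_weight (f : MvPolynomial σ ℤ) (z : σ → ℤ) (hz : ∀ i, (z i).natAbs ≤ 1) :
    (MvPolynomial.eval z f).natAbs ≤ weight f := by
  rw [MvPolynomial.eval_eq, weight]
  refine (Int.natAbs_sum_le _ _).trans (Finset.sum_le_sum fun m _ => ?_)
  rw [Int.natAbs_mul]
  refine (Nat.mul_le_mul_left _ ?_).trans (Nat.mul_one _).le
  rw [show (∏ i ∈ m.support, z i ^ m i).natAbs = ∏ i ∈ m.support, (z i ^ m i).natAbs from
    map_prod Int.natAbsHom _ _]
  refine Finset.prod_le_one (fun _ _ => Nat.zero_le _) fun i _ => ?_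
  rw [Int.natAbs_pow]
  exact pow_le_one₀ (Nat.zero_le _) (hz i)

end Weight

/-! ### Degree and weight of fan-in-two constant-free circuits (size form of Lemma 2.4) -/

section CircuitBounds

open ArithCircuit

variable {k : Type*} [CommSemiring k] {σ : Type*}

/-- The degree of a list sum is at most a common bound of the degrees of the summands. [folklore] -/
theorem totalDegree_list_sum_le_of_forall_le {D : ℕ} :
    ∀ (l : List (MvPolynomial σ k)), (∀ q ∈ l, q.totalDegree ≤ D) → l.sum.totalDegree ≤ D
  | [], _ => by simp
  | q :: l, h => by
    rw [List.sum_cons]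
    exact (totalDegree_add _ _).trans (max_le (h q (by simp))
      (totalDegree_list_sum_le_of_forall_le l fun r hr => h r (by simp [hr])))

/-- An operand read off a value list of degrees `≤ D` (`1 ≤ D`) has degree `≤ D` (junk
references read `0`). [folklore] -/
theorem totalDegree_operandEval_le {vals : List (MvPolynomial σ k)} {D : ℕ} (hD : 1 ≤ D)
    (hvals : ∀ v ∈ vals, v.totalDegree ≤ D) (u : Operand k σ) :
    (u.eval vals).totalDegree ≤ D := by
  cases u with
  | var i => exact (mvPolynomial_totalDegree_X_le_one _).trans hD
  | const c => simp [Operand.eval]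
  | gate j =>
    simp only [Operand.eval_gate, List.getD_eq_getElem?_getD]
    cases hj : vals[j]? with
    | none => simp
    | some v => exact hvals v (List.mem_of_getElem? hj)

/-- A gate of fan-in `≤ 2` over a value list of degrees `≤ D` (`1 ≤ D`) has degree `≤ 2 D`
(Bürgisser 2000 TCS, proof of Lemma 2.4: `deg(g_i g_j) ≤ deg g_i + deg g_j`,
`deg(g_i + g_j) ≤ max`). [cite: Burgisser2000TCS, Lemma 2.4 p. 77] -/
theorem totalDegree_gateEval_le {vals : List (MvPolynomial σ k)} {D : ℕ} (hD : 1 ≤ D)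
    (hvals : ∀ v ∈ vals, v.totalDegree ≤ D) (g : Gate k σ) (hg : g.fanIn ≤ 2) :
    (g.eval vals).totalDegree ≤ 2 * D := by
  cases g with
  | sum args =>
    simp only [Gate.eval]
    refine (totalDegree_list_sum_le_of_forall_le _ fun q hq => ?_).trans (Nat.le_mul_of_pos_left D two_pos)
    obtain ⟨a, -, rfl⟩ := List.mem_map.1 hq
    exact (totalDegree_smul_le _ _).trans (totalDegree_operandEval_le hD hvals _)
  | prod args =>
    simp only [Gate.eval]
    have hlen : args.length ≤ 2 := by simpa [Gate.fanIn, ArithCircuit.Gate.args] using hg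
    refine (totalDegree_list_prod _).trans ?_
    rw [List.map_map]
    calc (args.map (MvPolynomial.totalDegree ∘ fun u => u.eval vals)).sum
        ≤ (args.map (MvPolynomial.totalDegree ∘ fun u => u.eval vals)).length • D :=
          List.sum_le_card_nsmul _ _ fun d hd => by
            obtain ⟨u, -, rfl⟩ := List.mem_map.1 hd
            exact totalDegree_operandEval_le hD hvals u
      _ ≤ 2 * D := by
          rw [List.length_map, smul_eq_mul]; exact Nat.mul_le_mul_right _ hlen

/-- **Degree bound** (size form of Bürgisser 2000 TCS, Lemma 2.4, `deg f ≤ 2^{d*}` with the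
multiplicative depth `d*` bounded by the size): every gate value of a fan-in-two straight-line
program with `s` gates has degree `≤ 2^s`. [cite: Burgisser2000TCS, Lemma 2.4 p. 77] -/
theorem totalDegree_gateValues_le {gs : List (Gate k σ)} (h2 : ∀ g ∈ gs, g.fanIn ≤ 2) :
    ∀ v ∈ gateValues gs, v.totalDegree ≤ 2 ^ gs.length := by
  induction gs using List.reverseRecOn with
  | nil => simp [gateValues]
  | append_singleton gs g ih =>
    intro v hv
    have h2' : ∀ g' ∈ gs, g'.fanIn ≤ 2 := fun g' hg' => h2 g' (List.mem_append_left _ hg')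
    rw [gateValues_append_singleton, List.mem_append, List.mem_singleton] at hv
    rw [List.length_append, List.length_singleton, pow_succ]
    rcases hv with hv | rfl
    · exact (ih h2' v hv).trans (Nat.le_mul_of_pos_right _ two_pos)
    · rw [mul_comm]
      exact totalDegree_gateEval_le Nat.one_le_two_pow (ih h2') g (h2 g (by simp))

/-- **Degree bound for fan-in-two circuits**: `deg (P.eval) ≤ 2 ^ size P` (size form of
Bürgisser 2000 TCS, Lemma 2.4). [cite: Burgisser2000TCS, Lemma 2.4 p. 77] -/
theorem totalDegree_eval_le_two_pow_size {P : ArithCircuit k σ} (h2 : P.IsFanInTwo) :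
    P.eval.totalDegree ≤ 2 ^ P.size :=
  totalDegree_operandEval_le Nat.one_le_two_pow (totalDegree_gateValues_le h2) P.output

/-- The weight of a list sum is at most the sum of the weights. [cite: Burgisser2000TCS, §2 p. 76] -/
theorem weight_list_sum_le : ∀ l : List (MvPolynomial σ ℤ), weight l.sum ≤ (l.map weight).sum
  | [] => by simp
  | q :: l => by
    rw [List.sum_cons, List.map_cons, List.sum_cons]
    exact (weight_add_le _ _).trans (Nat.add_le_add_left (weight_list_sum_le l) _)

/-- The weight of a list product is at most the product of the weights. [cite: Burgisser2000TCS, §2 p. 76] -/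
theorem weight_list_prod_le : ∀ l : List (MvPolynomial σ ℤ), weight l.prod ≤ (l.map weight).prod
  | [] => by simp
  | q :: l => by
    rw [List.prod_cons, List.map_cons, List.prod_cons]
    exact (weight_mul_le _ _).trans (Nat.mul_le_mul_left _ (weight_list_prod_le l))

/-- A sign constant `c ∈ {0, 1, -1}` has `|c| ≤ 1`. [folklore] -/
theorem natAbs_le_one_of_isSignConstant {c : ℤ} (hc : IsSignConstant c) : c.natAbs ≤ 1 := by
  rcases hc with rfl | rfl | h
  · simp
  · simp
  · obtain rfl : c = -1 := by omega
    simp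

/-- Scaling by a sign constant does not increase the weight. [folklore] -/
theorem weight_smul_le_of_isSignConstant {c : ℤ} (hc : IsSignConstant c) (f : MvPolynomial σ ℤ) :
    weight (c • f) ≤ weight f := by
  rcases hc with rfl | rfl | h
  · simp
  · simp
  · obtain rfl : c = -1 := by omega
    simp

/-- An operand with sign constants read off a value list of weights `≤ W` (`1 ≤ W`) has weight
`≤ W`. [folklore] -/
theorem weight_operandEval_le {vals : List (MvPolynomial σ ℤ)} {W : ℕ} (hW : 1 ≤ W)
    (hvals : ∀ v ∈ vals, weight v ≤ W) {u : Operand ℤ σ} (hu : u.HasSignConstants) :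
    weight (u.eval vals) ≤ W := by
  cases u with
  | var i => simpa [Operand.eval] using hW
  | const c =>
    simp only [Operand.eval, weight_C]
    exact (natAbs_le_one_of_isSignConstant hu).trans hW
  | gate j =>
    simp only [Operand.eval_gate, List.getD_eq_getElem?_getD]
    cases hj : vals[j]? with
    | none => simp
    | some v => exact hvals v (List.mem_of_getElem? hj)

/-- A constant-free gate of fan-in `≤ 2` over a value list of weights `≤ W` (`2 ≤ W`) has weight
`≤ W²` (Bürgisser 2000 TCS, proof of Lemma 2.4: `wt(g_i g_j) ≤ wt g_i · wt g_j`,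
`wt(g_i + g_j) ≤ 2 max`). [cite: Burgisser2000TCS, Lemma 2.4 p. 77] -/
theorem weight_gateEval_le {vals : List (MvPolynomial σ ℤ)} {W : ℕ} (hW : 2 ≤ W)
    (hvals : ∀ v ∈ vals, weight v ≤ W) {g : Gate ℤ σ} (hg : g.fanIn ≤ 2)
    (hc : g.HasSignConstants) : weight (g.eval vals) ≤ W * W := by
  have hW1 : 1 ≤ W := le_trans one_le_two hW
  cases g with
  | sum args =>
    simp only [Gate.eval]
    have hlen : args.length ≤ 2 := by simpa [Gate.fanIn, ArithCircuit.Gate.args] using hg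
    refine (weight_list_sum_le _).trans ?_
    rw [List.map_map]
    calc (args.map (weight ∘ fun a => a.1 • a.2.eval vals)).sum
        ≤ (args.map (weight ∘ fun a => a.1 • a.2.eval vals)).length • W :=
          List.sum_le_card_nsmul _ _ fun d hd => by
            obtain ⟨a, ha, rfl⟩ := List.mem_map.1 hd
            exact (weight_smul_le_of_isSignConstant (hc a ha).1 _).trans
              (weight_operandEval_le hW1 hvals (hc a ha).2)
      _ ≤ 2 * W := by
          rw [List.length_map, smul_eq_mul]; exact Nat.mul_le_mul_right _ hlen
      _ ≤ W * W := Nat.mul_le_mul_right _ hW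
  | prod args =>
    simp only [Gate.eval]
    have hlen : args.length ≤ 2 := by simpa [Gate.fanIn, ArithCircuit.Gate.args] using hg
    refine (weight_list_prod_le _).trans ?_
    rw [List.map_map]
    calc (args.map (weight ∘ fun u => u.eval vals)).prod
        ≤ W ^ args.length := by
          rw [← List.length_map (f := weight ∘ fun u => u.eval vals)]
          exact List.prod_le_pow_card _ _ fun d hd => by
            obtain ⟨u, hu, rfl⟩ := List.mem_map.1 hd
            exact weight_operandEval_le hW1 hvals (hc u hu)
      _ ≤ W ^ 2 := Nat.pow_le_pow_right hW1 hlen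
      _ = W * W := sq W

/-- **Weight bound** (size form of Bürgisser 2000 TCS, Lemma 2.4 with `b = 2`): every gate value of
a constant-free fan-in-two straight-line program with `s` gates has weight `≤ 2^(2^s)`. [cite: Burgisser2000TCS, Lemma 2.4 p. 77] -/
theorem weight_gateValues_le {gs : List (Gate ℤ σ)} (h2 : ∀ g ∈ gs, g.fanIn ≤ 2)
    (hc : ∀ g ∈ gs, g.HasSignConstants) :
    ∀ v ∈ gateValues gs, weight v ≤ 2 ^ 2 ^ gs.length := by
  induction gs using List.reverseRecOn with
  | nil => simp [gateValues]
  | append_singleton gs g ih =>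
    intro v hv
    have h2' : ∀ g' ∈ gs, g'.fanIn ≤ 2 := fun g' hg' => h2 g' (List.mem_append_left _ hg')
    have hc' : ∀ g' ∈ gs, g'.HasSignConstants := fun g' hg' => hc g' (List.mem_append_left _ hg')
    rw [gateValues_append_singleton, List.mem_append, List.mem_singleton] at hv
    rw [List.length_append, List.length_singleton, pow_succ, pow_mul, sq]
    rcases hv with hv | rfl
    · exact (ih h2' hc' v hv).trans (Nat.le_mul_of_pos_right _ (Nat.two_pow_pos _))
    · exact weight_gateEval_le (by calc (2:ℕ) = 2 ^ 2 ^ 0 := by norm_num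
          _ ≤ 2 ^ 2 ^ gs.length := Nat.pow_le_pow_right two_pos (Nat.one_le_two_pow)) (ih h2' hc') (h2 g (by simp)) (hc g (by simp))

/-- **Weight bound for constant-free fan-in-two circuits**: `wt (P.eval) ≤ 2 ^ 2 ^ size P`
(size form of Bürgisser 2000 TCS, Lemma 2.4, `log wt(f) ≤ (d⁺ + 1) 2^{d*} log b`). [cite: Burgisser2000TCS, Lemma 2.4 p. 77] -/
theorem weight_eval_le_two_pow_two_pow_size {P : ArithCircuit ℤ σ} (h2 : P.IsFanInTwo)
    (hc : P.HasSignConstants) : weight P.eval ≤ 2 ^ 2 ^ P.size :=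
  weight_operandEval_le Nat.one_le_two_pow (weight_gateValues_le h2 hc.1) hc.2

end CircuitBounds

/-! ### The integer skeleton of a circuit: constants replaced by indeterminates -/

section Skeleton

open ArithCircuit

variable {k : Type*} [CommRing k] {σ : Type*}

/-- Slot variable `i`, clamped into `Fin (M + 1)` (genuine slots are `< M + 1`). [folklore] -/
def slotVar (M i : ℕ) : Fin (M + 1) := ⟨min i M, by omega⟩

/-- The slot of the coefficient of argument `t` of gate `j`: `4 j + 2 t`. [folklore] -/
def coefSlot (j t : ℕ) : ℕ := 4 * j + 2 * t

/-- The slot of a constant operand in argument `t` of gate `j`: `4 j + 2 t + 1`. [folklore] -/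
def constSlot (j t : ℕ) : ℕ := 4 * j + 2 * t + 1

/-- The constant carried by an operand (`0` for variables and gate references). [folklore] -/
def operandConst : Operand k σ → k
  | .const c => c
  | _ => 0

/-- Skeleton of an operand whose constant (if any) sits in slot `slot`: variables stay, a
constant becomes the slot variable `Y_slot`, a reference to gate `i` becomes a reference to gate
`3 i + 2` (each original gate becomes three skeleton gates) (Bürgisser 2000 TCS, §5 (A3), p. 85:
"Replace the `y_j` by indeterminates `Y_j`"). [cite: Burgisser2000TCS, §5 (A3) p. 85] -/
def skelOperand (M slot : ℕ) : Operand k σ → Operand ℤ (σ ⊕ Fin (M + 1))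
  | .var i => .var (Sum.inl i)
  | .const _ => .var (Sum.inr (slotVar M slot))
  | .gate i => .gate (3 * i + 2)

/-- The product gate `Y_{4j+2t} · u'` multiplying the skeleton of the operand `u` in argument `t`
of the sum gate `j` by the indeterminate standing for its coefficient. [cite: Burgisser2000TCS, §5 (A3) p. 85] -/
def coefGate (M j t : ℕ) (u : Operand k σ) : Gate ℤ (σ ⊕ Fin (M + 1)) :=
  .prod [.var (Sum.inr (slotVar M (coefSlot j t))), skelOperand M (constSlot j t) u]

/-- The three skeleton gates of gate `j`: for a sum gate `c₀ u₀ + c₁ u₁` the products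
`Y u₀'`, `Y' u₁'` and their sum (coefficients `1`); for a product gate two dummy gates `0` and the
product of the operand skeletons. Only the first two arguments are translated (fan-in two). [cite: Burgisser2000TCS, §5 (A3) p. 85] -/
def skelTriple (M j : ℕ) : Gate k σ → List (Gate ℤ (σ ⊕ Fin (M + 1)))
  | .sum [] => [.sum [], .sum [], .sum [(1, .gate (3 * j)), (1, .gate (3 * j + 1))]]
  | .sum [a] => [coefGate M j 0 a.2, .sum [], .sum [(1, .gate (3 * j)), (1, .gate (3 * j + 1))]]
  | .sum (a :: b :: _) =>
      [coefGate M j 0 a.2, coefGate M j 1 b.2, .sum [(1, .gate (3 * j)), (1, .gate (3 * j + 1))]]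
  | .prod [] => [.sum [], .sum [], .prod []]
  | .prod [u] => [.sum [], .sum [], .prod [skelOperand M (constSlot j 0) u]]
  | .prod (u :: v :: _) =>
      [.sum [], .sum [], .prod [skelOperand M (constSlot j 0) u, skelOperand M (constSlot j 1) v]]

/-- The skeleton gate list of a gate list starting at gate index `j`. [cite: Burgisser2000TCS, §5 (A3) p. 85] -/
def skelGates (M : ℕ) : ℕ → List (Gate k σ) → List (Gate ℤ (σ ⊕ Fin (M + 1)))
  | _, [] => []
  | j, g :: gs => skelTriple M j g ++ skelGates M (j + 1) gs

/-- **The integer skeleton** of a circuit `P` over `k`: the constant-free circuit over `ℤ` in the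
variables of `P` and the slot indeterminates `Y_0, …, Y_{4s}` obtained by replacing every sum
coefficient and every constant operand by its slot indeterminate (Bürgisser 2000 TCS, §5 (A3),
p. 85: "let `F_n(X, Y)` denote the integer polynomial computed by `Γ_n` from the `X_i` and
`Y_j`"). [cite: Burgisser2000TCS, §5 (A3) p. 85] -/
def skeleton (P : ArithCircuit k σ) : ArithCircuit ℤ (σ ⊕ Fin (4 * P.size + 1)) where
  gates := skelGates (4 * P.size) 0 P.gates
  output := skelOperand (4 * P.size) (4 * P.size) P.output

/-- The constant of `P` sitting in slot `i`: the coefficient (`i = 4j + 2t`) or constant operand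
(`i = 4j + 2t + 1`) of argument `t` of gate `j`, the output constant for `i = 4 s`, and `0` for
unused slots. [folklore] -/
def slotConst (P : ArithCircuit k σ) (i : ℕ) : k :=
  if i = 4 * P.size then operandConst P.output
  else match P.gates[i / 4]? with
    | none => 0
    | some (.sum args) => match args[i % 4 / 2]? with
      | none => 0
      | some a => if i % 2 = 0 then a.1 else operandConst a.2
    | some (.prod args) => match args[i % 4 / 2]? with
      | none => 0
      | some u => if i % 2 = 0 then 0 else operandConst u

/-- The substitution `X_i ↦ X_i`, `Y_v ↦ slotConst v` evaluating the skeleton back to `P`. [folklore] -/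
def slotSubst (P : ArithCircuit k σ) : σ ⊕ Fin (4 * P.size + 1) → MvPolynomial σ k :=
  Sum.elim X fun v => C (slotConst P v)

/-! #### Size and shape of the skeleton -/

omit [CommRing k] in
/-- Each gate contributes three skeleton gates. [folklore] -/
theorem length_skelTriple (M j : ℕ) (g : Gate k σ) : (skelTriple M j g).length = 3 := by
  rcases g with (_ | ⟨a, _ | ⟨b, l⟩⟩) | (_ | ⟨u, _ | ⟨v, l⟩⟩) <;> rfl

omit [CommRing k] in
/-- The skeleton has three gates per original gate. [folklore] -/
theorem length_skelGates (M : ℕ) : ∀ (j : ℕ) (gs : List (Gate k σ)),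
    (skelGates M j gs).length = 3 * gs.length
  | _, [] => rfl
  | j, g :: gs => by
    rw [skelGates, List.length_append, length_skelTriple, length_skelGates M (j + 1) gs,
      List.length_cons]
    ring

omit [CommRing k] in
/-- Skeleton gate lists of concatenations. [folklore] -/
theorem skelGates_append (M : ℕ) : ∀ (j : ℕ) (gs gs' : List (Gate k σ)),
    skelGates M j (gs ++ gs') = skelGates M j gs ++ skelGates M (j + gs.length) gs'
  | _, [], _ => by simp [skelGates]
  | j, g :: gs, gs' => by
    rw [List.cons_append, skelGates, skelGates, skelGates_append M (j + 1) gs gs',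
      List.append_assoc, List.length_cons, Nat.add_right_comm, Nat.add_assoc]

omit [CommRing k] in
/-- The size of the skeleton is three times the size of the circuit. [folklore] -/
theorem size_skeleton (P : ArithCircuit k σ) : (skeleton P).size = 3 * P.size :=
  length_skelGates _ _ _

omit [CommRing k] in
/-- The skeleton gates have fan-in `≤ 2`. [folklore] -/
theorem fanIn_skelTriple (M j : ℕ) (g : Gate k σ) : ∀ g' ∈ skelTriple M j g, g'.fanIn ≤ 2 := by
  rcases g with (_ | ⟨a, _ | ⟨b, l⟩⟩) | (_ | ⟨u, _ | ⟨v, l⟩⟩) <;>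
    simp [skelTriple, coefGate, Gate.fanIn, ArithCircuit.Gate.args]

omit [CommRing k] in
/-- The skeleton is a fan-in-two circuit. [folklore] -/
theorem isFanInTwo_skeleton (P : ArithCircuit k σ) : (skeleton P).IsFanInTwo := by
  suffices h : ∀ (M j : ℕ) (gs : List (Gate k σ)), ∀ g' ∈ skelGates M j gs, g'.fanIn ≤ 2 from
    h _ _ _
  intro M j gs
  induction gs generalizing j with
  | nil => simp [skelGates]
  | cons g gs ih =>
    intro g' hg'
    rw [skelGates, List.mem_append] at hg'
    exact hg'.elim (fanIn_skelTriple M j g g') (ih (j + 1) g')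

omit [CommRing k] in
/-- The skeleton gates are constant-free (coefficients `1`, no constant operands). [folklore] -/
theorem hasSignConstants_skelTriple (M j : ℕ) (g : Gate k σ) :
    ∀ g' ∈ skelTriple M j g, g'.HasSignConstants := by
  have hop : ∀ (sl : ℕ) (u : Operand k σ), (skelOperand M sl u : Operand ℤ _).HasSignConstants := by
    intro sl u; cases u <;> trivial
  have hmap : ∀ ts : List (ℕ × Operand k σ),
      (Gate.prod (ts.map fun q => skelOperand M q.1 q.2) : Gate ℤ (σ ⊕ Fin (M + 1))).HasSignConstants := by
    intro ts w hw
    obtain ⟨q, -, rfl⟩ := List.mem_map.1 hw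
    exact hop _ _
  have hcoef : ∀ (t : ℕ) (u : Operand k σ), (coefGate M j t u : Gate ℤ _).HasSignConstants := by
    intro t u w hw
    simp only [List.mem_cons, List.not_mem_nil, or_false] at hw
    rcases hw with rfl | rfl
    · trivial
    · exact hop _ u
  have hlink : (Gate.sum [(1, .gate (3 * j)), (1, .gate (3 * j + 1))] :
      Gate ℤ (σ ⊕ Fin (M + 1))).HasSignConstants := by
    intro a ha
    simp only [List.mem_cons, List.not_mem_nil, or_false] at ha
    rcases ha with rfl | rfl <;> exact ⟨Or.inr (Or.inl rfl), trivial⟩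
  have hzero : (Gate.sum ([] : List (ℤ × Operand ℤ (σ ⊕ Fin (M + 1))))).HasSignConstants :=
    fun a ha => absurd ha List.not_mem_nil
  rcases g with (_ | ⟨a, _ | ⟨b, l⟩⟩) | (_ | ⟨u, _ | ⟨v, l⟩⟩) <;> intro g' hg' <;>
    simp only [skelTriple, List.mem_cons, List.not_mem_nil, or_false] at hg' <;>
    rcases hg' with rfl | rfl | rfl <;>
    first
    | exact hzero
    | exact hlink
    | exact hcoef _ _
    | exact hmap []
    | exact hmap [(constSlot j 0, u)]
    | exact hmap [(constSlot j 0, u), (constSlot j 1, v)]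

omit [CommRing k] in
/-- The skeleton is a constant-free circuit. [folklore] -/
theorem hasSignConstants_skeleton (P : ArithCircuit k σ) : (skeleton P).HasSignConstants := by
  refine ⟨?_, by unfold skeleton; cases P.output <;> trivial⟩
  suffices h : ∀ (M j : ℕ) (gs : List (Gate k σ)), ∀ g' ∈ skelGates M j gs, g'.HasSignConstants from
    h _ _ _
  intro M j gs
  induction gs generalizing j with
  | nil => simp [skelGates]
  | cons g gs ih =>
    intro g' hg'
    rw [skelGates, List.mem_append] at hg'
    exact hg'.elim (hasSignConstants_skelTriple M j g g') (ih (j + 1) g')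

/-! #### The skeleton evaluates back to the circuit -/

/-- Genuine slots are not clamped. [folklore] -/
theorem val_slotVar_of_le {M i : ℕ} (h : i ≤ M) : (slotVar M i : ℕ) = i := min_eq_left h

/-- Read-back of the coefficient and constant-operand slots of argument `t < 2` of a sum gate. [folklore] -/
theorem slotConst_sum (P : ArithCircuit k σ) {j t : ℕ} {args : List (k × Operand k σ)}
    {a : k × Operand k σ} (hj : j < P.size) (hg : P.gates[j]? = some (Gate.sum args))
    (ha : args[t]? = some a) (ht : t < 2) :
    slotConst P (coefSlot j t) = a.1 ∧ slotConst P (constSlot j t) = operandConst a.2 := by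
  have h1 : coefSlot j t / 4 = j := by unfold coefSlot; omega
  have h2 : coefSlot j t % 4 / 2 = t := by unfold coefSlot; omega
  have h3 : coefSlot j t % 2 = 0 := by unfold coefSlot; omega
  have h4 : constSlot j t / 4 = j := by unfold constSlot; omega
  have h5 : constSlot j t % 4 / 2 = t := by unfold constSlot; omega
  have h6 : constSlot j t % 2 = 1 := by unfold constSlot; omega
  constructor
  · unfold slotConst
    rw [if_neg (by unfold coefSlot; omega), h1, hg]
    simp only [h2, ha, h3, if_true]
  · unfold slotConst
    rw [if_neg (by unfold constSlot; omega), h4, hg]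
    simp only [h5, ha, h6]
    simp

/-- Read-back of the constant-operand slot of argument `t < 2` of a product gate. [folklore] -/
theorem slotConst_prod (P : ArithCircuit k σ) {j t : ℕ} {args : List (Operand k σ)}
    {u : Operand k σ} (hg : P.gates[j]? = some (Gate.prod args))
    (hu : args[t]? = some u) (ht : t < 2) :
    slotConst P (constSlot j t) = operandConst u := by
  have h4 : constSlot j t / 4 = j := by unfold constSlot; omega
  have h5 : constSlot j t % 4 / 2 = t := by unfold constSlot; omega
  have h6 : constSlot j t % 2 = 1 := by unfold constSlot; omega
  unfold slotConst
  rw [if_neg (by unfold constSlot; omega), h4, hg]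
  simp only [h5, hu, h6]
  simp

/-- Read-back of the output slot. [folklore] -/
theorem slotConst_output (P : ArithCircuit k σ) : slotConst P (4 * P.size) = operandConst P.output := by
  unfold slotConst
  rw [if_pos rfl]

/-- The substitution on the variables of `P`: the identity. [folklore] -/
@[simp] theorem slotSubst_inl (P : ArithCircuit k σ) (i : σ) : slotSubst P (Sum.inl i) = X i := rfl

/-- The substitution on slot variables: the constant of the slot. [folklore] -/
@[simp] theorem slotSubst_inr (P : ArithCircuit k σ) (v : Fin (4 * P.size + 1)) :
    slotSubst P (Sum.inr v) = C (slotConst P v) := rfl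

/-- **Operand lemma.** If the skeleton value list `valsZ` (of length between `3j` and `3j + 2`)
evaluates back, at positions `3i + 2`, `i < j`, to the value list `vals` (of length `j`), then the
skeleton of an operand evaluates back to the operand, provided its slot holds its constant. [folklore] -/
theorem aeval_skelOperand (P : ArithCircuit k σ) {j : ℕ} {vals : List (MvPolynomial σ k)}
    {valsZ : List (MvPolynomial (σ ⊕ Fin (4 * P.size + 1)) ℤ)} (hvals : vals.length = j)
    (hlen : 3 * j ≤ valsZ.length) (hlen' : valsZ.length ≤ 3 * j + 2)
    (hrel : ∀ i, i < j → aeval (slotSubst P) (valsZ.getD (3 * i + 2) 0) = vals.getD i 0)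
    {slot : ℕ} (u : Operand k σ)
    (hslot : ∀ c, u = .const c → slotConst P (slotVar (4 * P.size) slot) = c) :
    aeval (slotSubst P) ((skelOperand (4 * P.size) slot u).eval valsZ) = u.eval vals := by
  cases u with
  | var i => simp [skelOperand, Operand.eval]
  | const c => simp [skelOperand, Operand.eval, hslot c rfl]
  | gate i =>
    simp only [skelOperand, Operand.eval_gate]
    rcases Nat.lt_or_ge i j with hi | hi
    · exact hrel i hi
    · rw [List.getD_eq_default _ _ (by omega), List.getD_eq_default _ _ (by omega), map_zero]

/-- `gateValues` of three more gates. [folklore] -/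
theorem gateValues_append_triple {R : Type*} [CommSemiring R] {τ : Type*} (gs : List (Gate R τ))
    (g₁ g₂ g₃ : Gate R τ) :
    gateValues (gs ++ [g₁, g₂, g₃]) =
      gateValues gs ++ [g₁.eval (gateValues gs), g₂.eval (gateValues gs ++ [g₁.eval (gateValues gs)]),
        g₃.eval (gateValues gs ++ [g₁.eval (gateValues gs),
          g₂.eval (gateValues gs ++ [g₁.eval (gateValues gs)])])] := by
  have h : gs ++ [g₁, g₂, g₃] = ((gs ++ [g₁]) ++ [g₂]) ++ [g₃] := by simp
  rw [h, gateValues_append_singleton, gateValues_append_singleton, gateValues_append_singleton]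
  simp

/-- Value of the linking sum gate `1 • Z_{3j} + 1 • Z_{3j+1}` after the two products. [folklore] -/
theorem eval_linkGate {R : Type*} [CommSemiring R] {τ : Type*} (valsZ : List (MvPolynomial τ R))
    {j : ℕ} (hlen : valsZ.length = 3 * j) (v₁ v₂ : MvPolynomial τ R) :
    (Gate.sum [(1, .gate (3 * j)), (1, .gate (3 * j + 1))] : Gate R τ).eval (valsZ ++ [v₁, v₂]) =
      v₁ + v₂ := by
  simp only [Gate.eval, List.map_cons, List.map_nil, List.sum_cons, List.sum_nil, add_zero, one_smul,
    Operand.eval_gate, List.getD_eq_getElem?_getD]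
  rw [List.getElem?_append_right (by omega), List.getElem?_append_right (by omega), hlen,
    Nat.sub_self, Nat.add_sub_cancel_left]
  simp


omit [CommRing k] in
/-- Value of a coefficient gate `Y · u'`. [folklore] -/
theorem eval_coefGate {M j t : ℕ} (u : Operand k σ) (V : List (MvPolynomial (σ ⊕ Fin (M + 1)) ℤ)) :
    (coefGate M j t u).eval V =
      X (Sum.inr (slotVar M (coefSlot j t))) * (skelOperand M (constSlot j t) u).eval V := by
  simp [coefGate, Gate.eval, Operand.eval]

/-- The constant of a constant operand. [folklore] -/
theorem operandConst_eq {u : Operand k σ} {c : k} (h : u = .const c) : operandConst u = c := by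
  subst h; rfl

/-- **The skeleton evaluates back to the circuit**: substituting the constants of `P` for the slot
indeterminates in the polynomial computed by the integer skeleton gives the polynomial computed by
`P` (Bürgisser 2000 TCS, §5 (A3), p. 85: "Obviously, `F_n(X, y) = f_n`"), for fan-in-two `P`. [cite: Burgisser2000TCS, §5 (A3) p. 85] -/
theorem aeval_slotSubst_skeleton (P : ArithCircuit k σ) (h2 : P.IsFanInTwo) :
    aeval (slotSubst P) (skeleton P).eval = P.eval := by
  -- the invariant along prefixes of the gate list
  have inv : ∀ j, j ≤ P.size → ∀ i, i < j →
      aeval (slotSubst P) ((gateValues (skelGates (4 * P.size) 0 (P.gates.take j))).getD (3 * i + 2) 0) =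
        (gateValues (P.gates.take j)).getD i 0 := by
    intro j
    induction j with
    | zero => intro _ i hi; omega
    | succ j ih =>
      intro hj
      have hjs : j < P.gates.length := hj
      have ih' := ih (Nat.le_of_succ_le hj)
      rw [List.take_succ_eq_append_getElem hjs, skelGates_append, List.length_take,
        Nat.min_eq_left hjs.le, Nat.zero_add, gateValues_append_singleton]
      simp only [skelGates, List.append_nil]
      generalize hgd : P.gates[j] = g
      generalize hvals_def : gateValues (List.take j P.gates) = vals at ih' ⊢
      generalize hA : skelGates (4 * P.size) 0 (List.take j P.gates) = A at ih' ⊢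
      have hg : P.gates[j]? = some g := by rw [List.getElem?_eq_getElem hjs, hgd]
      have hfan : g.fanIn ≤ 2 := hgd ▸ h2 _ (List.getElem_mem hjs)
      have hvl : vals.length = j := by
        rw [← hvals_def, gateValues_length, List.length_take]; omega
      have hvZl : (gateValues A).length = 3 * j := by
        rw [← hA, gateValues_length, length_skelGates, List.length_take]
        congr 1; omega
      -- the operand lemma on extensions of `gateValues A` by at most two values
      have hop : ∀ (ws : List (MvPolynomial (σ ⊕ Fin (4 * P.size + 1)) ℤ)), ws.length ≤ 2 →
          ∀ (slot : ℕ) (u : Operand k σ),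
            (∀ c, u = .const c → slotConst P (slotVar (4 * P.size) slot) = c) →
            aeval (slotSubst P) ((skelOperand (4 * P.size) slot u).eval (gateValues A ++ ws)) =
              u.eval vals := by
        intro ws hws slot u hslot
        refine aeval_skelOperand P hvl (by rw [List.length_append]; omega)
          (by rw [List.length_append]; omega) (fun i hi => ?_) u hslot
        rw [List.getD_append _ _ _ _ (by omega)]
        exact ih' i hi
      have hop0 : ∀ (slot : ℕ) (u : Operand k σ),
            (∀ c, u = .const c → slotConst P (slotVar (4 * P.size) slot) = c) →
            aeval (slotSubst P) ((skelOperand (4 * P.size) slot u).eval (gateValues A)) =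
              u.eval vals := fun slot u hslot =>
        aeval_skelOperand P hvl hvZl.ge (by omega) ih' u hslot
      have hM0 : ∀ t, t < 2 → coefSlot j t ≤ 4 * P.size := fun t ht => by unfold coefSlot; omega
      have hM1 : ∀ t, t < 2 → constSlot j t ≤ 4 * P.size := fun t ht => by unfold constSlot; omega
      intro i hi
      rcases Nat.lt_succ_iff_lt_or_eq.1 hi with hi | rfl
      · -- an old position: both lists are extended at the end only
        have key : ∀ (ws : List (MvPolynomial (σ ⊕ Fin (4 * P.size + 1)) ℤ)),
            (gateValues A ++ ws).getD (3 * i + 2) 0 = (gateValues A).getD (3 * i + 2) 0 := fun ws =>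
          List.getD_append _ _ _ _ (by omega)
        rw [List.getD_append _ _ _ _ (by omega)]
        rcases g with (_ | ⟨a, _ | ⟨b, l⟩⟩) | (_ | ⟨u, _ | ⟨v, l⟩⟩) <;>
          simp only [skelTriple] <;> rw [gateValues_append_triple, key] <;> exact ih' i hi
      · -- the new position `3 j + 2`: the third new value evaluates back to `g.eval vals`
        rw [List.getD_append_right _ _ _ _ (by omega), hvl, Nat.sub_self, List.getD_cons_zero]
        rcases g with (_ | ⟨a, _ | ⟨b, l⟩⟩) | (_ | ⟨u, _ | ⟨v, l⟩⟩)
        · -- empty sum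
          simp only [skelTriple]
          rw [gateValues_append_triple, List.getD_append_right _ _ _ _ (by omega), hvZl]
          simp only [Nat.add_sub_cancel_left, List.getD_cons_succ, List.getD_cons_zero,
            eval_linkGate (gateValues A) hvZl, map_add]
          simp [Gate.eval]
        · -- one summand
          obtain ⟨hc, hk⟩ := slotConst_sum P hjs hg (t := 0) rfl two_pos
          simp only [skelTriple]
          rw [gateValues_append_triple, List.getD_append_right _ _ _ _ (by omega), hvZl]
          simp only [Nat.add_sub_cancel_left, List.getD_cons_succ, List.getD_cons_zero,
            eval_linkGate (gateValues A) hvZl, map_add, eval_coefGate, map_mul, aeval_X, slotSubst_inr,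
            val_slotVar_of_le (hM0 0 two_pos), hc]
          rw [hop0 _ a.2 (fun c hc2 => by
            rw [val_slotVar_of_le (hM1 0 two_pos), hk, operandConst_eq hc2])]
          simp [Gate.eval, Operand.eval, MvPolynomial.C_mul']
        · -- two summands
          have hl : l = [] := by
            have h' := hfan
            simp only [Gate.fanIn, ArithCircuit.Gate.args, List.map_cons, List.length_cons,
              List.length_map] at h'
            exact List.eq_nil_of_length_eq_zero (by omega)
          subst hl
          obtain ⟨hc0, hk0⟩ := slotConst_sum P hjs hg (t := 0) rfl two_pos
          obtain ⟨hc1, hk1⟩ := slotConst_sum P hjs hg (t := 1) rfl one_lt_two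
          simp only [skelTriple]
          rw [gateValues_append_triple, List.getD_append_right _ _ _ _ (by omega), hvZl]
          simp only [Nat.add_sub_cancel_left, List.getD_cons_succ, List.getD_cons_zero,
            eval_linkGate (gateValues A) hvZl, map_add, eval_coefGate, map_mul, aeval_X, slotSubst_inr,
            val_slotVar_of_le (hM0 0 two_pos), val_slotVar_of_le (hM0 1 one_lt_two), hc0, hc1]
          rw [hop0 _ a.2 (fun c hc2 => by
            rw [val_slotVar_of_le (hM1 0 two_pos), hk0, operandConst_eq hc2]),
            hop [_] (by simp) _ b.2 (fun c hc2 => by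
            rw [val_slotVar_of_le (hM1 1 one_lt_two), hk1, operandConst_eq hc2])]
          simp [Gate.eval, MvPolynomial.C_mul']
        · -- empty product
          simp only [skelTriple]
          rw [gateValues_append_triple, List.getD_append_right _ _ _ _ (by omega), hvZl]
          simp [Gate.eval]
        · -- one factor
          have hk := slotConst_prod P hg (t := 0) rfl two_pos
          simp only [skelTriple]
          rw [gateValues_append_triple, List.getD_append_right _ _ _ _ (by omega), hvZl]
          simp only [Nat.add_sub_cancel_left, List.getD_cons_succ, List.getD_cons_zero]
          simp only [Gate.eval, List.map_cons, List.map_nil, List.prod_cons, List.prod_nil, mul_one]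
          rw [hop [_, _] (by simp) _ u (fun c hc2 => by
            rw [val_slotVar_of_le (hM1 0 two_pos), hk, operandConst_eq hc2])]
        · -- two factors
          have hl : l = [] := by
            have h' := hfan
            simp only [Gate.fanIn, ArithCircuit.Gate.args, List.length_cons] at h'
            exact List.eq_nil_of_length_eq_zero (by omega)
          subst hl
          have hk0 := slotConst_prod P hg (t := 0) rfl two_pos
          have hk1 := slotConst_prod P hg (t := 1) rfl one_lt_two
          simp only [skelTriple]
          rw [gateValues_append_triple, List.getD_append_right _ _ _ _ (by omega), hvZl]
          simp only [Nat.add_sub_cancel_left, List.getD_cons_succ, List.getD_cons_zero]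
          simp only [Gate.eval, List.map_cons, List.map_nil, List.prod_cons, List.prod_nil, mul_one,
            map_mul]
          rw [hop [_, _] (by simp) _ u (fun c hc2 => by
            rw [val_slotVar_of_le (hM1 0 two_pos), hk0, operandConst_eq hc2]),
            hop [_, _] (by simp) _ v (fun c hc2 => by
            rw [val_slotVar_of_le (hM1 1 one_lt_two), hk1, operandConst_eq hc2])]
  -- the output operand
  have hfull := inv P.size le_rfl
  have htake : P.gates.take P.size = P.gates := List.take_of_length_le le_rfl
  rw [htake] at hfull
  unfold skeleton ArithCircuit.eval
  simp only
  refine aeval_skelOperand P (j := P.size) (by rw [gateValues_length]; rfl)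
    (by rw [gateValues_length, length_skelGates]; rfl)
    (by rw [gateValues_length, length_skelGates]; simp [ArithCircuit.size]) hfull P.output
    fun c hc => ?_
  rw [val_slotVar_of_le le_rfl, slotConst_output, operandConst_eq hc]

/-- **The skeleton lemma** (Bürgisser 2000 TCS, §5 (A3), p. 85, with the size form of Lemma 2.4):
a fan-in-two circuit `P` over `k` with `s` gates has a constant-free fan-in-two integer skeleton
`Q` with `3 s` gates in the variables of `P` and `4 s + 1` slot indeterminates, together with
constants `y` (the constants of `P`, slot by slot) such that substituting `y` for the slot
indeterminates in the polynomial `F = Q.eval ∈ ℤ[X, Y]` gives the polynomial computed by `P`;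
moreover `deg F ≤ 2^{3s}` and `wt F ≤ 2^{2^{3s}}`. [cite: Burgisser2000TCS, §5 (A3) p. 85 and Lemma 2.4 p. 77] -/
theorem exists_skeleton (P : ArithCircuit k σ) (h2 : P.IsFanInTwo) :
    ∃ (Q : ArithCircuit ℤ (σ ⊕ Fin (4 * P.size + 1))) (y : Fin (4 * P.size + 1) → k),
      Q.IsFanInTwo ∧ Q.HasSignConstants ∧ Q.size = 3 * P.size ∧
      aeval (Sum.elim X fun v => C (y v)) Q.eval = P.eval ∧
      Q.eval.totalDegree ≤ 2 ^ (3 * P.size) ∧ weight Q.eval ≤ 2 ^ 2 ^ (3 * P.size) := by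
  refine ⟨skeleton P, fun v => slotConst P v, isFanInTwo_skeleton P, hasSignConstants_skeleton P,
    size_skeleton P, aeval_slotSubst_skeleton P h2, ?_, ?_⟩
  · rw [← size_skeleton P]
    exact totalDegree_eval_le_two_pow_size (isFanInTwo_skeleton P)
  · rw [← size_skeleton P]
    exact weight_eval_le_two_pow_two_pow_size (isFanInTwo_skeleton P) (hasSignConstants_skeleton P)

end Skeleton

end Literature.Computability.AlgebraicComplexity
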